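import Summits.QuantumAdvantage.QuantumAdvantage.Theses.ArithStatLadder
import Literature.NumberTheory.QuadraticFields.ThreeTorsion
import Literature.Computability.Cryptography.HallgrenPell
import HarnessLib.Audit

/-!
# Skeleton line `mirror-unit-signature` for crux `ArithStatLadder.AvgFaceBeyondPrior` (stmt-QuantumAdvantage-2427)

Crux (route `ArithStatLadder`, rank 7, auto-crux, hypothesis-type): `AvgFaceBeyondPrior` =
`(IQ3, U) ∉ Heur_{1/3}BPP`, `IQ3 = {bin d : −d fundamental, 3 ∣ h(−d)}`, `Uₙ` uniform on the n-bit `d`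
with `−d` fundamental (Disproof/Negative `avgFace_iff`: every PPT `A(x,1ⁿ)` has bad `Uₙ`-mass `> 1/3` at
some level).

## The line (crux idea cards `mirror-unit-signature` ≈ `scholz-mirror-unit-trit`, triage r1: 3 × pass)

LEVER: Scholz's reflection READ WITH ITS UNIT DEFECT. For `−d` fundamental let `k = ℚ(√3d)` (fundamental
discriminant `D⁺ = mirrorDisc d ∈ {3d, d/3}`, square-free kernel `d₀ = mirrorRadicand d`), `ε = (a+b√d₀)/2`
its fundamental unit. Kummer theory over `K = k(ζ₃) ∋ √−d` and Hecke's criterion at the primes above `3`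
(`e(𝔓∣3) = 2`, modulus `𝔓³`) give the EXACT identity
  `3 ∣ h(−d)  ⟺  [ε is a cube mod 𝔓³ for all 𝔓 ∣ 3]  ∨  [3 ∣ h(k)]`            (d ≠ 3)
whose first disjunct is ONE 3-adic digit of the unit: `ε⁸ ≡ 1 (mod 9𝒪_k)` if `3 ∤ D⁺`, `(mod 𝔭³)` if
`3 ∥ D⁺` — spelled below over `ℤ[√d₀]` as `UnitCubeAtThree d` (re ≡ 4, im ≡ 0 mod 9 resp. 3 for
`(a+b√d₀)⁸`; no table, no class field theory in the STATEMENT). Consequences: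
* (transport) `IQ3 = RealFace := {d : −d fund., d ≠ 3, UnitCubeAtThree d ∨ #Cl₃(D⁺) ≠ 1}` EXACTLY, so the
  crux is literally the statement that the JOINT real face (unit cube-class ∨ real 3-rank of `ℚ(√3d)`) is
  `Heur_{1/3}BPP`-hard on `U` — `AvgFaceBeyondPrior_of` below (stubs 1–3; pure bookkeeping, PROVED);
* (assembly, the card's point) the unit language `L_ε = {d : −d fund., d ≠ 3, UnitCubeAtThree d}` is in `BQP`
  WITH NO RIEMANN HYPOTHESIS (Shor for fundamentality + Hallgren's regulator + Jacobson–Williams' unit residue,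
  ALL PROVED in the tree) and disagrees with `IQ3` only on `{#Cl₃(D⁺) ≠ 1}`, of `U`-mass `≤ 1/6 + o(1)`
  (Davenport–Heilbronn for real fields with a 3-adic local condition); since `1/6 + 1/6 = 1/3 = δ`, a `BPP`
  machine for `L_ε` would put `(IQ3,U)` in `Heur_{1/3}BPP`. Hence `quantumAdvantage_of_crux` below
  (stubs 2,4,5,6; PROVED): **the crux ALONE decides the summit, GRH-free** — versus the route's current
  `closes (IqThreeMemBQP [GRH-blocked]) (IqThreeNotPPoly [hypothesis])`;
* (refutation surface, for cdisprove) `not_avgFace_of_unitCubeLang_mem_BPP`: any classical polynomial-time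
  algorithm for `ε_{ℚ(√3d)} mod 9` (even a heuristic one off a `1/6`-set) refutes the crux.

HONEST STATUS (all three triagers, and this planner, agree): the crux is separation-strength
(`Negative.avgFace_imp_not_mem_BPP`: crux ⇒ `IQ3 ∉ BPP`; with `IQ3 ∈ NP` ⇒ `NP ⊄ BPP`), so NO line closes it;
stub 3 (`stub_realFaceHard`) is the crux in mirror coordinates — hypothesis-type, ≥ `NP ⊄ BPP`, NOT TO BE
STAFFED. The unit-only and the `{#Cl₃(D⁺)=1}`-conditioned transfers are LOSSY (a `Heur_{1/3}` decider for `IQ3`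
is only `Heur_{1/2}` for `L_ε`, resp. `Heur_{2/5}` on the conditioned ensemble, both trivial at prior `1/3`;
TRIAGE-r1-1 correction, re-derived by this planner), which is WHY the hard stub must keep both disjuncts.
The EARNABLE content of the line is stubs 4–6 (theorem-grade, inputs in the tree) + the vendoring of stubs 1–2
(classical theorems; statements fully elementary and kit-certified), after which the tenure planner can
re-certify the route with `closes′ := quantumAdvantage_of_crux` (one hypothesis-type input instead of two, no GRH).

## Disproof used (`Cruxes/AvgFaceBeyondPrior/Disproof.lean` v2/v3; landed `Theorems/AvgFaceBeyondPrior/Negative/*`)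
* `avgFaceBeyondPrior_false_without_PPT` — PPT is used exactly once, inside stub 3 (and, on the assembly side,
  inside the `BPP` hypothesis of stub 6).
* `not_avgFace_unconditioned` (conditioning on fundamental `−d` is load-bearing) — every set here is cut by
  `IsNegFund`; `Uₙ` is the literal `ens` (= landed `Negative.ens`); no domination transfer anywhere.
* `avgFace_imp_exists_level(_ge)` (density of `3 ∣ h(−d)` must exceed `1/3` i.o.) — untouched: by the
  transport it reads `Uₙ(UnitCube ∨ #Cl₃(D⁺) ≠ 1) > 1/3` i.o., the arithmetic shadow of stub 3 (CL: 0.2800 + 0.1599).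
* `mem_HeurDeltaBPP_of_mem_BPP` / `paramLift` — the exact tool stub 6 extends (bad set relocated from `∅`
  to the disagreement set, finite patch below `n₀`).
* `not_avgFace_of_not_summit` (crux ∧ IqThreeMemBQP ⇒ summit, GRH inside) — REPLACED by
  `quantumAdvantage_of_crux` (GRH-free).
* No `-- Targets` stub kill exists; no landed Negative lemma refutes an instance of any stub (they concern the
  δ-axis, PPT-necessity, conditioning and block counts). The landed `Negative/*.lean` files are not imported
  (the farm had not built them when this skeleton was checked); their literal definitions are copied below
  (`iq3Set`, `iq3Lang`, `fundBlock`, `ens`, `Q`, `avgFace_iff_Q` — all `rfl`-equal to `Negative.*`).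

## Numerics (kit j012491, `compute/unitcube_check.gp`, attached to the item; j012496 = the `d < 2^17` sub-run)
The arithmetic spelling `UnitCubeAtThree` is certified AS TYPED on ALL 159 375 fundamental `−d` with `4 ≤ d < 2^19`:
ZERO violations of stub 2 (i) (`cube ∧ 3 ∤ h`), of stub 2 (ii) (`#Cl₃(D⁺) = 1 ∧ 3 ∣ h ∧ ¬cube`), of stub 1
(`r ≤ s ≤ r+1`), and of `quaddisc(d₀) = mirrorDisc d`; and `Uₙ(RealFace) = Uₙ(IQ3)` EXACTLY in every window
`n ≤ 19`. Window `n = 19` (79 704 fields): `q = Uₙ(3 ∣ h) = 0.4004`, `Uₙ(cube) = 0.3129`, `Uₙ(#Cl₃(D⁺) ≠ 1) = 0.1272`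
(the disagreement budget, limit `≤ 1/6`, CL `0.1599`), `Uₙ(IQ3 △ L_ε) = 0.0875`, `Uₙ(cube ∧ #Cl₃(D⁺) ≠ 1) = 0.0397`.
This is on top of three independent implementations of the equivalent ideal-theoretic test (j011009: 0/19 932;
j011183 + j011217: 0/92 099; triage j011764/j011985). Hand checks in the docstrings: `d = 23, 31, 87` cube & `3 ∣ h`;
`d = 15, 20, 24, 47` not cube & `3 ∤ h`.
-/

noncomputable section

open scoped Classical
open Filter

set_option linter.dupNamespace false

namespace Summit.QuantumAdvantage.QuantumAdvantage.Cruxes.AvgFaceBeyondPrior.MirrorUnitSignature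

open _root_.Computability
open Literature.Computability.Complexity Literature.Computability.MetaComplexity
  Literature.Computability.Cryptography Literature.NumberTheory.QuadraticFields
open Summit.QuantumAdvantage.QuantumAdvantage.Theses.ArithStatLadder

/-! ### Vocabulary of the line (to be landed verbatim as `Theorems/ArithStatLadderAvgFaceBeyondPriorMirrorDefs.lean`
by the lead, `--kind definition`, before the stubs are fanned out; nothing here is a route item) -/

/-- `−d` is a (negative) fundamental discriminant — the route's LITERAL predicate (an `abbrev`, so every term
below is syntactically about the route's sets). [folklore] -/
abbrev IsNegFund (d : ℕ) : Prop :=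
  (((-(d:ℤ)) % 4 = 1 ∧ Squarefree (-(d:ℤ)) ∧ (-(d:ℤ)) ≠ 1) ∨
    (4 ∣ (-(d:ℤ)) ∧ ((-(d:ℤ)) / 4 % 4 = 2 ∨ (-(d:ℤ)) / 4 % 4 = 3) ∧ Squarefree ((-(d:ℤ)) / 4)))

/-- The set `IQ3 ⊆ ℕ`: `−d` fundamental and `3 ∣ h(−d)` — literal copy of the route's set (as in the landed
`Theorems/AvgFaceBeyondPrior/Negative/AvgFaceBeyondPriorNecessary.lean`, `Negative.iq3Set`). [folklore] -/
def iq3Set : Set ℕ :=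
  {d : ℕ | (((-(d:ℤ)) % 4 = 1 ∧ Squarefree (-(d:ℤ)) ∧ (-(d:ℤ)) ≠ 1) ∨ (4 ∣ (-(d:ℤ)) ∧ ((-(d:ℤ)) / 4 % 4 = 2 ∨ (-(d:ℤ)) / 4 % 4 = 3) ∧ Squarefree ((-(d:ℤ)) / 4))) ∧ 3 ∣ Literature.NumberTheory.QuadraticFields.BinaryQuadraticForm.classNumber (-(d:ℤ))}

/-- The language `IQ3` (LSB-first binary), literal (`Negative.iq3Lang`). [folklore] -/
def iq3Lang : Set (List Bool) := encodingNatBool.toLanguage iq3Set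

/-- The dyadic block `𝒟ₙ` of n-bit `d` with `−d` fundamental — literal copy of the route's finset, the support of
`Uₙ` (`Negative.fundBlock`). [folklore] -/
def fundBlock (n : ℕ) : Finset ℕ :=
  (Finset.Ico (2 ^ (n - 1)) (2 ^ n)).filter (fun d : ℕ => (((-(d:ℤ)) % 4 = 1 ∧ Squarefree (-(d:ℤ)) ∧ (-(d:ℤ)) ≠ 1) ∨ (4 ∣ (-(d:ℤ)) ∧ ((-(d:ℤ)) / 4 % 4 = 2 ∨ (-(d:ℤ)) / 4 % 4 = 3) ∧ Squarefree ((-(d:ℤ)) / 4))))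

/-- The route's ensemble `U`: uniform on `fundBlock n` pushed to strings, `pure []` if empty — literal
(`Negative.ens`). [folklore] -/
def ens : Ensemble := fun n =>
  if h : (fundBlock n).Nonempty then (PMF.uniformOfFinset (fundBlock n) h).map encodeNat
  else PMF.pure []

/-- The distributional problem `(IQ3, U)` of the crux (`Negative.Q`). [folklore] -/
def Q : DistProblem := ⟨iq3Lang, ens⟩

/-- The crux is literally `Q ∉ Heur_{1/3}BPP` (definitional, as `Negative.avgFace_iff_Q`). [folklore] -/
theorem avgFace_iff_Q :
    Summit.QuantumAdvantage.QuantumAdvantage.Theses.ArithStatLadder.AvgFaceBeyondPrior ↔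
      Q ∉ HeurDeltaBPP (fun _ => (1:ℝ) / 3) := Iff.rfl

/-- **The mirror discriminant** `D⁺(d) = disc ℚ(√3d) = disc ℚ(√(−3·(−d)))`: `d/3` if `3 ∣ d`, `3d` otherwise.
For `−d` fundamental this IS a positive fundamental discriminant in all residue cases (`d ≡ 3 (4)`:
`3d ≡ 1 (4)` resp. `d/3 ≡ 1 (4)`; `d = 4d₁`: `4·(3d₁)` resp. `4·(d₁/3)` with `3d₁, d₁/3 ≡ 2,3 (4)`), degenerate
only at `d = 3` (`D⁺ = 1`). Scholz's mirror pair is `(ℚ(√D⁺), ℚ(√(−3D⁺)) = ℚ(√−d))`. [cite: Scholz1932] -/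
def mirrorDisc (d : ℕ) : ℤ := if 3 ∣ d then ((d / 3 : ℕ) : ℤ) else 3 * (d : ℤ)

/-- **The mirror radicand** `d₀` = square-free kernel of `3d` (so `ℚ(√d₀) = ℚ(√D⁺)`, `D⁺ ∈ {d₀, 4d₀}`):
strip the `4` of an even fundamental discriminant, then move the `3` across. This is the square-free input
that `Hallgren2007_regulator_qsolvable(_delim)` and `JacobsonWilliams2008_unitResidue_mem_FP` take. [folklore] -/
def mirrorRadicand (d : ℕ) : ℕ :=
  if 3 ∣ d then (if 4 ∣ d then d / 12 else d / 3) else (if 4 ∣ d then 3 * (d / 4) else 3 * d)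

/-- `(a, b)` are the half-integral coordinates of THE fundamental unit `ε = (a + b√d₀)/2 > 1` of the ring of
integers of `ℚ(√d₀)`, `d₀ = mirrorRadicand d` — written arithmetically EXACTLY as in the hypothesis of
`JacobsonWilliams2008_unitResidue_mem_FP` (`b > 0`, `a² − d₀b² = ±4`, `a` least): for square-free `d₀` the
units are the `(a + b√d₀)/2` with `a² − d₀ b² = ±4`, and `a = ε ± ε⁻¹` increases along powers. [cite: JacobsonWilliams2008, Ch. 12] -/
def IsMirrorFundUnit (d a b : ℕ) : Prop :=
  0 < b ∧
    ((a:ℤ) ^ 2 - (mirrorRadicand d : ℤ) * (b:ℤ) ^ 2 = 4 ∨ (a:ℤ) ^ 2 - (mirrorRadicand d : ℤ) * (b:ℤ) ^ 2 = -4) ∧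
    ∀ a' b' : ℕ, 0 < b' →
      ((a':ℤ) ^ 2 - (mirrorRadicand d : ℤ) * (b':ℤ) ^ 2 = 4 ∨ (a':ℤ) ^ 2 - (mirrorRadicand d : ℤ) * (b':ℤ) ^ 2 = -4) →
        a ≤ a'

/-- `(a + b√d₀)⁸ = 2⁸ε⁸ ∈ ℤ[√d₀]` (Mathlib `Zsqrtd`; `.re`, `.im` its coordinates). [folklore] -/
def unitPow8 (d a b : ℕ) : Zsqrtd (mirrorRadicand d : ℤ) :=
  (⟨(a:ℤ), (b:ℤ)⟩ : Zsqrtd (mirrorRadicand d : ℤ)) ^ 8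

/-- **The unit signature (3-adic cube class of the mirror unit), arithmetic spelling.** For `k = ℚ(√d₀)`,
`K = k(ζ₃)`, every `𝔓 ∣ 3` of `K` has `e(𝔓∣3) = 2`, so by Hecke (Satz 119, `v_𝔓(1−ζ₃) = 1`) `K(∛ε)/K` is
unramified at `𝔓` iff `ε ≡ ξ³ (mod 𝔓³)`. Cubing kills the 1-units mod `𝔓³` and is bijective on
`(𝒪_K/𝔓)ˣ` (order `3^f − 1 ∣ 8`), so "`ε` is a cube mod `𝔓³` for all `𝔓 ∣ 3`" ⟺ `ε⁸ ≡ 1 (mod rad(3𝒪_K)³ ∩ 𝒪_k)`,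
and `rad(3𝒪_K)³ ∩ 𝒪_k = 9𝒪_k` if `3 ∤ d₀` (⟺ `3 ∣ d`; `K/k` ramified over `3`), `= 𝔭³ = 3𝔭` if `3 ∣ d₀`
(⟺ `3 ∤ d`; `𝔭² = 3𝒪_k`, `K/k` unramified at `𝔭`). Multiplying by the unit `2⁸ ≡ 4 (mod 9)` and using
`[𝒪_k : ℤ[√d₀]] ≤ 2` (prime to `3`): with `(a+b√d₀)⁸ = X + Y√d₀`, the condition is `X ≡ 4 (mod 9)` and
`9 ∣ Y` (if `3 ∣ d`), resp. `3 ∣ Y` (if `3 ∤ d`; `𝔭³ ∩ ℤ[√d₀] = {9 ∣ x, 3 ∣ y}`). Worked checks: `d = 23`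
(`d₀ = 69`, `ε = (25+3√69)/2`, `(25+3√69)⁸ ≡ 4 + 6√69 (mod 9)`: cube; `h(−23) = 3`), `d = 87` (`d₀ = 29`,
`ε = (5+√29)/2`, `⁸ ≡ 4`: cube; `h(−87) = 6`), `d = 24` (`d₀ = 2`, `(2+2√2)⁸ ≡ 4 + 3√2`, `9 ∤ 3`: not;
`h(−24) = 2`), `d = 20` (`d₀ = 15`, `(8+2√15)⁸ ≡ 7 + 5√15`: not; `h(−20) = 2`). The witness `(a,b)` is unique
(least `a`), so the `∃` is a definite description. [cite: Scholz1932] [cite: JacobsonWilliams2008, Ch. 12] -/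
def UnitCubeAtThree (d : ℕ) : Prop :=
  ∃ a b : ℕ, IsMirrorFundUnit d a b ∧ (unitPow8 d a b).re % 9 = 4 ∧
    (3 ∣ d → (9:ℤ) ∣ (unitPow8 d a b).im) ∧ (¬ 3 ∣ d → (3:ℤ) ∣ (unitPow8 d a b).im)

/-- The GRH-free quantum language of the line: `L_ε = {d : −d fundamental, d ≠ 3, UnitCubeAtThree d}` (as a
set of naturals; `d = 3`, where `D⁺ = 1`, is excluded). [folklore] -/
def unitCubeSet : Set ℕ := {d : ℕ | IsNegFund d ∧ d ≠ 3 ∧ UnitCubeAtThree d}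

/-- `L_ε` as a language (LSB-first binary, the route's `encodingNatBool`). [folklore] -/
def unitCubeLang : Language Bool := encodingNatBool.toLanguage unitCubeSet

/-- **The real face of `IQ3`**: `−d` fundamental, `d ≠ 3`, and (the mirror unit is a cube at `3` OR the REAL
field `ℚ(√3d)` has a 3-torsion ideal class). By Scholz + Hecke this set IS `IQ3` (`mem_iq3Set_iff_mem_realFaceSet`). [cite: Scholz1932] -/
def realFaceSet : Set ℕ :=
  {d : ℕ | IsNegFund d ∧ d ≠ 3 ∧ (UnitCubeAtThree d ∨ quadFieldThreeTorsion (mirrorDisc d) ≠ 1)}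

/-- Agreement of a set `T ⊆ ℕ` with `IQ3` off a `(1/6 + ε)`-fraction of every late dyadic block of fundamental
discriminants (`fundBlock n` = the route's literal finset, the support of `Uₙ`). [folklore] -/
def MirrorAgreement (T : Set ℕ) : Prop :=
  ∀ ε : ℝ, 0 < ε → ∀ᶠ n : ℕ in atTop,
    ((((fundBlock n).filter fun d : ℕ =>
        ¬ (3 ∣ BinaryQuadraticForm.classNumber (-(d:ℤ)) ↔ d ∈ T)).card : ℝ))
      ≤ (1 / 6 + ε) * ((fundBlock n).card : ℝ)

/-! ### Sanity of the vocabulary (kernel-checked small cases) -/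

example : mirrorDisc 23 = 69 ∧ mirrorDisc 87 = 29 ∧ mirrorDisc 24 = 8 ∧ mirrorDisc 20 = 60 := by decide
example : mirrorRadicand 23 = 69 ∧ mirrorRadicand 87 = 29 ∧ mirrorRadicand 24 = 2 ∧ mirrorRadicand 20 = 15 ∧
    mirrorRadicand 84 = 7 := by decide

/-- `h(−3) = 1`, so `3 ∤ h(−3)`: the degenerate point `d = 3` (`D⁺ = 1`) lies outside `IQ3`. [folklore] -/
theorem not_three_dvd_classNumber_neg_three : ¬ (3 ∣ BinaryQuadraticForm.classNumber (-3)) := by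
  decide

/-- A `d` with `−d` fundamental is positive. [folklore] -/
theorem pos_of_isNegFund {d : ℕ} (h : IsNegFund d) : 0 < d := by
  rcases Nat.eq_zero_or_pos d with rfl | hpos
  · rcases h with h | h <;> norm_num at h
  · exact hpos

/-! ### The registered stubs -/

/-- STUB 1 (classical theorem, Scholz 1932 = Washington GTM 83 Thm 10.10; CFT-grade as a formalisation: vendor
as a named Literature fact `Scholz1932_reflection` and discharge in one line, or prove via Kummer duality) —
**Scholz's Spiegelungssatz for the pair `(ℚ(√3d), ℚ(√−d))`** in torsion counts: `#Cl₃(D⁺) ≤ #Cl₃(−d) ≤ 3·#Cl₃(D⁺)`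
(`r ≤ s ≤ r + 1`). Only the left inequality is load-bearing for `AvgFaceBeyondPrior_of` (it puts `{#Cl₃(D⁺) ≠ 1}`
inside `IQ3`); the right one is the printed theorem's other half (and what makes the unit defect a single trit).
Degenerate `d = 3`: `D⁺ = 1` is not a discriminant, junk value `quadFieldThreeTorsion 1 = 1`, both inequalities
hold (`h(−3) = 1`). Numerically: kit j012491, 0 violations of either inequality on 159 375 fields (`d < 2^19`);
j011183/j011217 (`s ∈ {r, r+1}` on 92 099 fields). -/
theorem stub_scholzReflection :
    ∀ d : ℕ, IsNegFund d →
      quadFieldThreeTorsion (mirrorDisc d) ≤ quadFieldThreeTorsion (-(d:ℤ)) ∧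
        quadFieldThreeTorsion (-(d:ℤ)) ≤ 3 * quadFieldThreeTorsion (mirrorDisc d) := by
  sorry

/-- STUB 2 (classical theorem: Kummer theory over `K = ℚ(√−d, ζ₃)` + Hecke, Vorlesungen Satz 118–119 + the count
behind Scholz's theorem; Gras arXiv:2206.13931 Thm 7.1 uses direction (i) verbatim; CFT-grade as a formalisation —
vendor as ONE named fact with this elementary statement) — **the unit criterion**: for `−d` fundamental, `d ≠ 3`,
(i) if the fundamental unit of `ℚ(√3d)` is a cube at `3` (`UnitCubeAtThree d`) then `3 ∣ h(−d)` (the Kummer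
extension `K(∛ε)` descends to an UNRAMIFIED `C₃`-extension of `ℚ(√−d)`: `ε·ε^g = Nε = ±1` is a cube, unramified
outside `3` because `ε` is a unit, at `3` by Hecke); (ii) if moreover `ℚ(√3d)` has no 3-torsion class
(`#Cl₃(D⁺) = 1`) then conversely `3 ∣ h(−d)` forces `UnitCubeAtThree d` (the Kummer generators of exponent-3
unramified extensions of `ℚ(√−d)` live in `V_k = {β : (β) = 𝔟³}/k^{×3}`, of dimension `r₃(k) + 1 = 1`, i.e. `⟨ε⟩`).
This is the ONLY place class field theory enters the line. Certified AS TYPED (mod-9 spelling) by kit j012491: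
0 violations of (i) and of (ii) among the 159 375 fundamental `−d`, `d < 2^19` (and 0 / 112 031 in three equivalent
ideal-theoretic implementations before). Cheapest falsifier: one `d`. -/
theorem stub_unitCubeCriterion :
    ∀ d : ℕ, IsNegFund d → d ≠ 3 →
      (UnitCubeAtThree d → 3 ∣ BinaryQuadraticForm.classNumber (-(d:ℤ))) ∧
        (quadFieldThreeTorsion (mirrorDisc d) = 1 →
          3 ∣ BinaryQuadraticForm.classNumber (-(d:ℤ)) → UnitCubeAtThree d) := by
  sorry

/-- STUB 3 (HYPOTHESIS-TYPE — the transfer target `C⁺`; separation-strength, `≥ NP ⊄ BPP`; DO NOT STAFF; refuters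
first) — **the real face is `Heur_{1/3}BPP`-hard**: no PPT algorithm is confidently correct on `≥ 2/3` of the
`Uₙ`-mass, for every `n`, about membership in `RealFace = {d : −d fund., d ≠ 3, UnitCubeAtThree d ∨ #Cl₃(D⁺) ≠ 1}`
— a statement about the REAL quadratic field `ℚ(√3d)` only (one 3-adic digit of its fundamental unit, or a
3-torsion ideal class), on the route's literal ensemble `ens = U`. By stubs 1–2 it is EQUIVALENT to the
crux (exact transport, `AvgFaceBeyondPrior_of` / `realFaceHard_of_crux`); it is NOT implied by hardness of the
unit digit alone nor of the real 3-rank alone (lossy transfers: `Heur_{1/2}`, resp. useless), and either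
component being classically easy on average REFUTES it (`not_avgFace_of_unitCubeLang_mem_BPP`; symmetrically a
PPT detector of `3 ∣ h(ℚ(√3d))` answers YES there and NO elsewhere with failure `Uₙ(cube ∧ #Cl₃(D⁺)=1) → 0.28 < 1/3`
under CL). Its necessary arithmetic shadow is `Uₙ(RealFace) > 1/3` i.o. (`Negative.avgFace_imp_exists_level`
transported; CL value `0.4399 = 0.2800 + 0.1599`; OPEN). -/
theorem stub_realFaceHard :
    (⟨encodingNatBool.toLanguage realFaceSet, ens⟩ : DistProblem) ∉
      HeurDeltaBPP (fun _ => (1 : ℝ) / 3) := by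
  sorry

/-- STUB 4 (M given ONE new cite fact; theorem-grade) — **3-torsion is rare in the mirror family**: for every
`ε > 0`, eventually in `n`, at most `(1/6 + ε)·#𝒟ₙ` of the `d ∈ 𝒟ₙ` have `#Cl₃(ℚ(√3d)) ≠ 1`. Source: the
Davenport–Heilbronn REAL mean `4/3` of `#Cl₃` UNDER A LOCAL CONDITION AT 3 (Bhargava–Varma 2016 = arXiv:1401.5875
Cor. 4 / Thm 3, 'acceptable' families, `p = 3` allowed; Nakagawa–Horie 1988), applied to the two image families of
`d ↦ D⁺` — `{D⁺ ≡ 0 (3)} ∩ [3·2^{n−1}, 3·2ⁿ)` and `{D⁺ ≢ 0 (3)} ∩ [2^{n−1}/3, 2ⁿ/3)` (a bijection of `𝒟ₙ ∖ {3}` onto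
their union) — differenced over the dyadic window, then Markov with `#Cl₃ ≥ 3` on `{#Cl₃ ≠ 1}`
(`exists_quadFieldThreeTorsion_eq_pow`): mass `≤ (4/3 − 1)/2 + o(1) = 1/6 + o(1)`. NOT covered by the tree's
`tt_threeTorsion_sum_progression` (needs `gcd(6a, m) = 1`) nor by `bst_threeTorsion_mean.pos` alone (no local
condition: useless bound): the BV fact is cite work item wi-29874 (filed by this planner). Keep `1/6 + ε`
(CL value `0.1599`: no room for a smaller constant). Numerics: `P(#Cl₃(D⁺) ≠ 1) = 0.070 (d < 3000)`, `0.114 (n = 16)`,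
`0.133 (d ≈ 10⁶)`, increasing to `0.16`. -/
theorem stub_mirrorRankRare :
    ∀ ε : ℝ, 0 < ε → ∀ᶠ n : ℕ in atTop,
      ((((fundBlock n).filter fun d : ℕ => quadFieldThreeTorsion (mirrorDisc d) ≠ 1).card : ℝ))
        ≤ (1 / 6 + ε) * ((fundBlock n).card : ℝ) := by
  sorry

/-- STUB 5 (L; theorem-grade, EVERY input PROVED in the tree — an assembly in the `Shor.lean` / `CentralFactorial`
style, no number theory beyond the definitions) — **the unit language is in `BQP`, with no Riemann hypothesis**:
on input `bin d`, (1) decide `IsNegFund d` — square-freeness of `d` resp. `d/4` via the factorisation of `d`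
(`factoring_mem_FBQP_holds` / `FACT_mem_BQP_holds`, `isQSolvable_of_mem_BQP_oracle`-type closure); (2) compute
`d₀ = mirrorRadicand d` (trivial `FP`); (3) Hallgren: an integer `r` within `1` of the regulator of `ℚ(√d₀)`
(`Hallgren2007_regulator_qsolvable_delim_holds`, square-free `d₀ ≥ 2` — true for `d ≠ 3`); (4) Jacobson–Williams:
`(a mod 9, b mod 9)` for the fundamental unit `(a + b√d₀)/2` from `⟨bin d₀, ⟨bin r, bin 9⟩⟩`
(`JacobsonWilliams2008_unitResidue_mem_FP_holds`, whose hypothesis IS `IsMirrorFundUnit d a b`); (5) evaluate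
`(a + b√d₀)⁸ mod 9` and the two divisibility tests (an `FP` post-processing, `isQSolvable_classicalWrap_holds`),
output one bit (`mem_BQP_of_isQSolvable_bit`). Mathlib's `NumberField.Units.regulator` of a real quadratic field is
`log ε` (1×1 regulator matrix), which links (3) to (4)'s `|log((a + b√d₀)/2) − r| < 1`. -/
theorem stub_unitCubeMemBQP : unitCubeLang ∈ BQP := by
  sorry

/-- STUB 6 (M; provable now, generic heuristic-class plumbing) — **the mirror transfer**: if a set `T` agrees with
`IQ3` off a `(1/6 + ε)`-fraction of every late block and `bin T ∈ BPP`, then `(IQ3, U) ∈ Heur_{1/3}BPP`, i.e. the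
crux fails. Proof: amplify the `BPP` machine to error `≤ 1/8` (`exists_randAlg_error_le_of_mem_BPP_holds`), truncate
and lift to `(x, 1ⁿ)` exactly as in `Negative.mem_HeurDeltaBPP_of_mem_BPP` (`paramLift`); at level `n ≥ n₀` its bad
set for `IQ3` (coin error `≥ 1/4`) is contained in `bin` of the disagreement filter, of `Uₙ`-mass `≤ 1/6 + 1/6 = 1/3`
(`MirrorAgreement` at `ε = 1/6`, `ens_prob_eq`); below `n₀` patch with the finite table of `IQ3 ∩ [0, 2^{n₀})`
(PPT: `tableFn_mem_FP`-style `FP` toolkit, as the disprover's `patchAlg` in Disproof v3), bad mass `0`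
(the `pure []` levels `n ≤ 1` included: `Negative.nil_not_mem_iq3Lang`). -/
theorem stub_heurTransfer :
    ∀ T : Set ℕ, MirrorAgreement T → encodingNatBool.toLanguage T ∈ BPP →
      ¬ Summit.QuantumAdvantage.QuantumAdvantage.Theses.ArithStatLadder.AvgFaceBeyondPrior := by
  sorry

/-! ### Name-keyed aliases of the stub statements (the skeleton audit admits a hypothesis of the composition only
if its head constant is a registered obligation or is named like a declared stub) -/
namespace Registered

/-- Alias of stub 1's statement keyed by the stub name. -/
abbrev stub_scholzReflection : Prop :=
  ∀ d : ℕ, IsNegFund d →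
    quadFieldThreeTorsion (mirrorDisc d) ≤ quadFieldThreeTorsion (-(d:ℤ)) ∧
      quadFieldThreeTorsion (-(d:ℤ)) ≤ 3 * quadFieldThreeTorsion (mirrorDisc d)
/-- Alias of stub 2's statement keyed by the stub name. -/
abbrev stub_unitCubeCriterion : Prop :=
  ∀ d : ℕ, IsNegFund d → d ≠ 3 →
    (UnitCubeAtThree d → 3 ∣ BinaryQuadraticForm.classNumber (-(d:ℤ))) ∧
      (quadFieldThreeTorsion (mirrorDisc d) = 1 →
        3 ∣ BinaryQuadraticForm.classNumber (-(d:ℤ)) → UnitCubeAtThree d)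
/-- Alias of stub 3's statement keyed by the stub name. -/
abbrev stub_realFaceHard : Prop :=
  (⟨encodingNatBool.toLanguage realFaceSet, ens⟩ : DistProblem) ∉ HeurDeltaBPP (fun _ => (1 : ℝ) / 3)
/-- Alias of stub 4's statement keyed by the stub name. -/
abbrev stub_mirrorRankRare : Prop :=
  ∀ ε : ℝ, 0 < ε → ∀ᶠ n : ℕ in atTop,
    ((((fundBlock n).filter fun d : ℕ => quadFieldThreeTorsion (mirrorDisc d) ≠ 1).card : ℝ))
      ≤ (1 / 6 + ε) * ((fundBlock n).card : ℝ)
/-- Alias of stub 5's statement keyed by the stub name. -/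
abbrev stub_unitCubeMemBQP : Prop := unitCubeLang ∈ BQP
/-- Alias of stub 6's statement keyed by the stub name. -/
abbrev stub_heurTransfer : Prop :=
  ∀ T : Set ℕ, MirrorAgreement T → encodingNatBool.toLanguage T ∈ BPP →
    ¬ Summit.QuantumAdvantage.QuantumAdvantage.Theses.ArithStatLadder.AvgFaceBeyondPrior

end Registered

/-! ### Glue, PROVED: the exact transport `IQ3 = RealFace` -/

/-- Off the degenerate point, a nontrivial 3-torsion class of `ℚ(√3d)` forces `3 ∣ h(−d)` (Scholz's `r ≤ s`, then
Cauchy in `Cl(ℚ(√−d))` through the PROVED bridge `three_dvd_classNumber_iff_one_lt_quadFieldThreeTorsion`). [folklore] -/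
theorem three_dvd_classNumber_of_mirrorTorsion_ne_one (h1 : Registered.stub_scholzReflection) {d : ℕ}
    (hf : IsNegFund d) (ht : quadFieldThreeTorsion (mirrorDisc d) ≠ 1) :
    3 ∣ BinaryQuadraticForm.classNumber (-(d:ℤ)) := by
  have hle := (h1 d hf).1
  have hpos := quadFieldThreeTorsion_pos (mirrorDisc d)
  have hneg : (-(d:ℤ)) < 0 := by
    have := pos_of_isNegFund hf
    omega
  rw [three_dvd_classNumber_iff_one_lt_quadFieldThreeTorsion hf hneg]
  omega

/-- **`IQ3 = RealFace` pointwise** (stubs 1–2): for every `d`, `d ∈ IQ3` (the landed literal `iq3Set`)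
iff `−d` is fundamental, `d ≠ 3`, and the mirror unit is a cube at `3` or `#Cl₃(D⁺) ≠ 1`. [folklore] -/
theorem mem_iq3Set_iff_mem_realFaceSet (h1 : Registered.stub_scholzReflection)
    (h2 : Registered.stub_unitCubeCriterion) (d : ℕ) : d ∈ iq3Set ↔ d ∈ realFaceSet := by
  simp only [iq3Set, realFaceSet, Set.mem_setOf_eq]
  constructor
  · rintro ⟨hf, h3⟩
    have hne : d ≠ 3 := by
      rintro rfl
      exact not_three_dvd_classNumber_neg_three h3
    refine ⟨hf, hne, ?_⟩
    by_cases ht : quadFieldThreeTorsion (mirrorDisc d) = 1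
    · exact Or.inl ((h2 d hf hne).2 ht h3)
    · exact Or.inr ht
  · rintro ⟨hf, hne, hc | ht⟩
    · exact ⟨hf, (h2 d hf hne).1 hc⟩
    · exact ⟨hf, three_dvd_classNumber_of_mirrorTorsion_ne_one h1 hf ht⟩

/-- Hence the two languages, and the two distributional problems on the route's ensemble, coincide. [folklore] -/
theorem q_eq_realFaceProblem (h1 : Registered.stub_scholzReflection) (h2 : Registered.stub_unitCubeCriterion) :
    Q = (⟨encodingNatBool.toLanguage realFaceSet, ens⟩ : DistProblem) := by
  have hset : iq3Set = realFaceSet := Set.ext (mem_iq3Set_iff_mem_realFaceSet h1 h2)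
  simp only [Q, iq3Lang, hset]

/-! ### The composition: stubs 1–3 imply the crux, BY NAME -/

/-- **`AvgFaceBeyondPrior` from stubs 1–3** (no `sorry`): the crux is `Q ∉ Heur_{1/3}BPP`
(`avgFace_iff_Q`, `Iff.rfl` on the route's literal text); by Scholz (stub 1) and the unit criterion
(stub 2), `Q` IS the real-face problem (`q_eq_realFaceProblem`); stub 3 is its hardness. -/
theorem AvgFaceBeyondPrior_of (h1 : Registered.stub_scholzReflection) (h2 : Registered.stub_unitCubeCriterion)
    (h3 : Registered.stub_realFaceHard) :
    Summit.QuantumAdvantage.QuantumAdvantage.Theses.ArithStatLadder.AvgFaceBeyondPrior := by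
  rw [avgFace_iff_Q, q_eq_realFaceProblem h1 h2]
  exact h3

/-- Wiring check: the registered stubs feed `AvgFaceBeyondPrior_of` as stated. -/
example : Summit.QuantumAdvantage.QuantumAdvantage.Theses.ArithStatLadder.AvgFaceBeyondPrior :=
  AvgFaceBeyondPrior_of stub_scholzReflection stub_unitCubeCriterion stub_realFaceHard

/-- Conversely the crux gives stub 3 (so stub 3 is EXACTLY as strong as the crux, given stubs 1–2 — recorded so
that nobody mistakes the transport for progress on the crux itself). [folklore] -/
theorem realFaceHard_of_crux (h1 : Registered.stub_scholzReflection) (h2 : Registered.stub_unitCubeCriterion)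
    (hc : Summit.QuantumAdvantage.QuantumAdvantage.Theses.ArithStatLadder.AvgFaceBeyondPrior) :
    Registered.stub_realFaceHard := by
  rw [avgFace_iff_Q, q_eq_realFaceProblem h1 h2] at hc
  exact hc

/-! ### The assembly side, PROVED: with stubs 2, 4, 5, 6 the crux ALONE decides the summit (GRH-free closes′) -/

/-- **Mirror agreement of the unit language** (stub 2 + stub 4): `L_ε` and `IQ3` disagree only inside
`{#Cl₃(D⁺) ≠ 1}` (at `d = 3` both say no: `h(−3) = 1`), a `(1/6 + ε)`-fraction of late blocks. [folklore] -/
theorem mirrorAgreement_unitCubeSet (h2 : Registered.stub_unitCubeCriterion) (h4 : Registered.stub_mirrorRankRare) :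
    MirrorAgreement unitCubeSet := by
  intro ε hε
  filter_upwards [h4 ε hε] with n hn
  refine le_trans ?_ hn
  have hsub : ((fundBlock n).filter fun d : ℕ =>
        ¬ (3 ∣ BinaryQuadraticForm.classNumber (-(d:ℤ)) ↔ d ∈ unitCubeSet))
      ⊆ ((fundBlock n).filter fun d : ℕ => quadFieldThreeTorsion (mirrorDisc d) ≠ 1) := by
    intro d hd
    rw [Finset.mem_filter] at hd ⊢
    refine ⟨hd.1, fun ht => hd.2 ?_⟩
    have hf : IsNegFund d := (Finset.mem_filter.1 hd.1).2
    simp only [unitCubeSet, Set.mem_setOf_eq]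
    by_cases h3 : d = 3
    · subst h3
      exact iff_of_false not_three_dvd_classNumber_neg_three fun h => h.2.1 rfl
    · exact ⟨fun hdiv => ⟨hf, h3, (h2 d hf h3).2 ht hdiv⟩, fun hm => (h2 d hf h3).1 hm.2.2⟩
  exact_mod_cast Finset.card_le_card hsub

/-- **The refutation surface** (stubs 2, 4, 6): a classical `BPP` algorithm for the unit language — i.e. for the
cube class of `ε_{ℚ(√3d)}` modulo `9𝒪_k` on fundamental inputs — REFUTES the crux. No such algorithm is known
(residues of fundamental units resist even conjecture: Ankeny–Artin–Chowla; the one proved unit statistic,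
negative Pell, runs on Rédei symbols, i.e. genus theory, which is void at `3`). For the cdisprove seat. [folklore] -/
theorem not_avgFace_of_unitCubeLang_mem_BPP (h2 : Registered.stub_unitCubeCriterion)
    (h4 : Registered.stub_mirrorRankRare) (h6 : Registered.stub_heurTransfer) (hB : unitCubeLang ∈ BPP) :
    ¬ Summit.QuantumAdvantage.QuantumAdvantage.Theses.ArithStatLadder.AvgFaceBeyondPrior :=
  h6 unitCubeSet (mirrorAgreement_unitCubeSet h2 h4) hB

/-- **closes′ — TRANSFER OF ROLE (no `sorry`): with stubs 2, 4, 5, 6 the crux ALONE implies the summit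
`QuantumAdvantage = ∃ L, L ∈ BQP ∧ L ∉ BPP`, the witness being the unit language `L_ε` (in `BQP` by stub 5 with
NO Riemann hypothesis; not in `BPP` by the refutation surface).** Compare the route's `closes (IqThreeMemBQP)
(IqThreeNotPPoly)` (GRH inside the first, a `P/poly` hypothesis as the second) and the disprover's
`Negative.not_avgFace_of_not_summit`. Recommended to the tenure planner as the route's deciding theorem once
stubs 2, 4, 5, 6 are items (`ledger workitem add` ×4 + `ledger route edit --closes-file`). [folklore] -/
theorem quantumAdvantage_of_crux (h2 : Registered.stub_unitCubeCriterion) (h4 : Registered.stub_mirrorRankRare)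
    (h5 : Registered.stub_unitCubeMemBQP) (h6 : Registered.stub_heurTransfer)
    (hc : Summit.QuantumAdvantage.QuantumAdvantage.Theses.ArithStatLadder.AvgFaceBeyondPrior) :
    _root_.QuantumAdvantage := by
  by_contra hno
  refine not_avgFace_of_unitCubeLang_mem_BPP h2 h4 h6 ?_ hc
  by_contra hB
  exact hno ⟨unitCubeLang, h5, hB⟩

/-- Wiring check of the assembly side with the registered stubs. -/
example (hc : Summit.QuantumAdvantage.QuantumAdvantage.Theses.ArithStatLadder.AvgFaceBeyondPrior) :
    _root_.QuantumAdvantage :=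
  quantumAdvantage_of_crux stub_unitCubeCriterion stub_mirrorRankRare stub_unitCubeMemBQP stub_heurTransfer hc

end Summit.QuantumAdvantage.QuantumAdvantage.Cruxes.AvgFaceBeyondPrior.MirrorUnitSignature

end
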